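import Summits.HubbardSuperconductivity.HubbardSuperconductivity.Theorems.ChiralWindowCwThesisChannelInfNonpos
import Summits.HubbardSuperconductivity.HubbardSuperconductivity.Theorems.ChiralWindowCwThesisA1gReduction
import Summits.HubbardSuperconductivity.HubbardSuperconductivity.Theorems.ChiralWindowCwKLChiralWindowReductionL2
import HarnessLib

/-!
# Route `ChiralWindow`, crux `CwThesis` (stmt-HubbardSuperconductivity-10438), line `SketchIdeator3` v6:
# the anchor from a `U`-FREE Kohn–Luttinger certificate at one window doping

Write `ε = squareDispersion 1 0`, `μ_δ = chemicalPotentialOfDensity ε (1-δ)`, `σ = fermiCurveMeasure ε μ`,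
`Γ_U(k,k') = U + U² χ₀(k+k')` (`kohnLuttingerKernel`), `Λ_U(μ,χ) = channelInf ε μ U χ` (bottom of `⟨ψ, Γ_U ψ⟩` over the
normalised gap functions of the irrep `χ`). After v5 (`cwThesis_of_klCanonical_of_leading`, this namespace) the crux
`ChiralWindow.CwThesis` follows from the sibling crux `TorusCooperLog.KLCanonical` (stmt-2681) and a LEADING datum at ONE window
doping, `∃ γ U₁ > 0, ∀ U ∈ (0,U₁), ∀ χ ≠ B1g, Λ_U(μ_δ₀,B1g) + γU² ≤ Λ_U(μ_δ₀,χ)` — a `U`-DEPENDENT family of inequalities. This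
file pushes it down to `U`-FREE data, i.e. to the kind of statement a certified computation (cruxes stmt-2682 `CertB1g`,
stmt-1741 `CwKLChiralWindow`, stmt-0158) actually delivers:

* `channelInf_sq_of_ne_A1g` — the crux-1741 Hilbert–Schmidt frame assembled at a band level `μ ∈ (-4,0)`:
  `Λ_U(μ,χ) = U² Λ_1(μ,χ)` for every `χ ≠ A1g` and every `U` (mean zero of non-`A1g` states on the `D₄`-invariant finite
  Fermi-curve measure, `stub_klMeanZero`/`stub_klD4Invariant`, and `kl_rl_channelInf_sq_of_meanZero`);
* `leading_of_certificateOne` — the `U = 1` certificate `Λ_1(μ,B1g) + γ ≤ Λ_1(μ,χ)` (`χ ≠ B1g`) gives the leading datum for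
  EVERY `U ∈ (0,1)` with the same `γ` (bare-`U` penalty `U² Λ_1(χ) ≤ Λ_U(χ)`, `kl_rl_sq_channelInf_one_le`);
* `leading_of_klCertificateAt` — the SHARP form for the `s`-wave competitor (RaghuKivelsonScalapino2010 §III; the stmt-2682
  docstring: "A1g competes only through states orthogonal to constants"): the inequalities `Λ_1(B1g) + γ ≤ Λ_1(χ)` for
  `χ ∉ {B1g, A1g}` together with the MEAN-ZERO bound `Λ_1(B1g) + γ ≤ ⟨φ, Γ_1 φ⟩` for `A1g` channel states `φ` with `∫φ dσ = 0`
  give the leading datum with margin `γ/2` below `U₁ = min 1 (γ/(2C+1))`, by `stub_a1gReduction` (`Λ_U(A1g) ≥ U² λ⊥ - C U³`);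
* `cwThesis_of_klCanonical_of_klCertificate` — **the anchor from the `U`-free certificate**: `KLCanonical` and that certificate
  at one `δ₀ ∈ [3/10, 12/25]` give `CwThesis` (registered stub of the lead skeleton `Cruxes/CwThesis/Lines/SketchIdeator3.lean`, v6);
  `cwThesis_of_klCanonical_of_certificateOne` — the same from the cruder `U = 1` certificate, which implies the sharp one
  (`klCertificate_of_certificateOne`).

Numerically (NON-certified census of the crux-1741 chain, `Cruxes/CwKLChiralWindow/CertSpec.md` §0 and the job logs recorded on
stmt-1741: j009446, j007919, j008735, j007226) `B1g` leads every channel from half filling down to `n* ≈ 0.5876` (`δ* ≈ 0.412`);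
at `δ = 2/5` the `U = 1` margin is `≈ 7·10⁻³` with `|Λ_1| ≈ 1.9·10⁻²`, and `A1g⊥`, `A2g` stay `≥ 5.9·10⁻³` above the leader even
at the crossing. No definitions; nothing here is certified numerics. References: S. Raghu, S. A. Kivelson, D. J. Scalapino,
Phys. Rev. B 81 (2010) 224505, §II (7), (13), §III; W. Kohn, J. M. Luttinger, Phys. Rev. Lett. 15 (1965) 524.
-/

noncomputable section

-- the tree's namespace repeats the summit name by design (D-0017)
set_option linter.dupNamespace false

namespace Summit.HubbardSuperconductivity.HubbardSuperconductivity.Theorems.CwThesis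

open MeasureTheory Real Set Filter
open Literature.MathematicalPhysics.QuantumLattice
open Summit.HubbardSuperconductivity.HubbardSuperconductivity.Theses

/-! ### The frame at a band level -/

/-- **`U²`-homogeneity off `A1g` at a band level**: for `-4 < μ < 0`, every `U` and every `χ ≠ A1g`,
`Λ_U(μ,χ) = U² Λ_1(μ,χ)` (every non-`A1g` channel state has mean zero on the `D₄`-invariant finite Fermi-curve measure).
[cite: RaghuKivelsonScalapino2010, §II (7)] -/
theorem channelInf_sq_of_ne_A1g {μ : ℝ} (hμ : μ ∈ Set.Ioo (-4 : ℝ) 0) (U : ℝ) {χ : D4Irrep} (hχ : χ ≠ D4Irrep.A1g) :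
    channelInf (squareDispersion 1 0) μ U χ = U ^ 2 * channelInf (squareDispersion 1 0) μ 1 χ := by
  have hfin : IsFiniteMeasure (fermiCurveMeasure (squareDispersion 1 0) μ) :=
    stub_klFiniteMeasure stub_klGradient stub_klHausdorffFinite μ hμ
  have hinv := stub_klD4Invariant stub_klGradient μ hμ
  exact kl_rl_channelInf_sq_of_meanZero hμ.1 hμ.2 U χ (fun ψ hψ => (stub_klMeanZero _ _ hfin hinv χ ψ hχ hψ).2)

/-- **The `U = 1` certificate at a band level gives the leading datum for every `U ∈ (0,1)`.** For `-4 < μ < 0` and a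
margin `γ`: if `Λ_1(μ,B1g) + γ ≤ Λ_1(μ,χ)` for every `χ ≠ B1g`, then `Λ_U(μ,B1g) + γU² ≤ Λ_U(μ,χ)` for every `U ∈ (0,1)`
and every `χ ≠ B1g` (`Λ_U(B1g) = U² Λ_1(B1g)` and `U² Λ_1(χ) ≤ Λ_U(χ)`). [cite: RaghuKivelsonScalapino2010, §II (7) and (13)] -/
theorem leading_of_certificateOne {μ γ : ℝ} (hμ : μ ∈ Set.Ioo (-4 : ℝ) 0)
    (hcert : ∀ χ : D4Irrep, χ ≠ D4Irrep.B1g →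
      channelInf (squareDispersion 1 0) μ 1 D4Irrep.B1g + γ ≤ channelInf (squareDispersion 1 0) μ 1 χ) :
    ∀ U ∈ Set.Ioo (0:ℝ) 1, ∀ χ : D4Irrep, χ ≠ D4Irrep.B1g →
      channelInf (squareDispersion 1 0) μ U D4Irrep.B1g + γ * U ^ 2 ≤ channelInf (squareDispersion 1 0) μ U χ := by
  intro U hU χ hχ
  rw [channelInf_sq_of_ne_A1g hμ U (show D4Irrep.B1g ≠ D4Irrep.A1g by decide)]
  have hpen := kl_rl_sq_channelInf_one_le hμ.1 hμ.2 hU.1 hU.2.le χ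
  have h1 := mul_le_mul_of_nonneg_left (hcert χ hχ) (sq_nonneg U)
  nlinarith

/-- **The cruder `U = 1` certificate implies the sharp (mean-zero `A1g`) one** at the same `δ₀`, same `γ`: clause (a) is a
sub-case, and for a mean-zero `A1g` channel state `φ`, `Λ_1(A1g) ≤ ⟨φ, Γ_1 φ⟩` (the `A1g` image set is bounded below,
`kl_rl_bddBelow`). [folklore] -/
theorem klCertificate_of_certificateOne {δ₀ γ : ℝ} (hδ₀ : δ₀ ∈ Set.Icc (3/10 : ℝ) (12/25))
    (hcert : ∀ χ : D4Irrep, χ ≠ D4Irrep.B1g →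
      channelInf (squareDispersion 1 0) (chemicalPotentialOfDensity (squareDispersion 1 0) (1 - δ₀)) 1 D4Irrep.B1g + γ ≤
        channelInf (squareDispersion 1 0) (chemicalPotentialOfDensity (squareDispersion 1 0) (1 - δ₀)) 1 χ) :
    (∀ χ : D4Irrep, χ ≠ D4Irrep.B1g → χ ≠ D4Irrep.A1g →
        channelInf (squareDispersion 1 0) (chemicalPotentialOfDensity (squareDispersion 1 0) (1 - δ₀)) 1 D4Irrep.B1g + γ ≤
          channelInf (squareDispersion 1 0) (chemicalPotentialOfDensity (squareDispersion 1 0) (1 - δ₀)) 1 χ) ∧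
      (∀ φ : Momentum → ℝ,
        IsChannelState (squareDispersion 1 0) (chemicalPotentialOfDensity (squareDispersion 1 0) (1 - δ₀)) D4Irrep.A1g φ →
        ∫ k, φ k ∂fermiCurveMeasure (squareDispersion 1 0) (chemicalPotentialOfDensity (squareDispersion 1 0) (1 - δ₀)) = 0 →
          channelInf (squareDispersion 1 0) (chemicalPotentialOfDensity (squareDispersion 1 0) (1 - δ₀)) 1 D4Irrep.B1g + γ ≤
            pairingForm (squareDispersion 1 0) (chemicalPotentialOfDensity (squareDispersion 1 0) (1 - δ₀)) 1 φ) := by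
  have hμ := stub_klMuWindow δ₀ hδ₀
  refine ⟨fun χ hχ _ => hcert χ hχ, fun φ hφ _ => (hcert D4Irrep.A1g (by decide)).trans ?_⟩
  exact csInf_le (kl_rl_bddBelow hμ.1 hμ.2 1 D4Irrep.A1g) ⟨φ, hφ, rfl⟩

/-! ### The `A1g` competitor through mean-zero states, and the leading datum from the `U`-free certificate -/

/-- **Second-order lower bound for the `A1g` bottom** (from `stub_a1gReduction`): a mean-zero bound `λ⊥ ≤ ⟨φ, Γ_1 φ⟩` over
`A1g` channel states with `∫φ dσ = 0` gives `U² λ⊥ - C U³ ≤ Λ_U(μ, A1g)` for `U ∈ (0,1)` (the `A1g` channel-state set is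
nonempty, `nonempty_isChannelState`). [cite: RaghuKivelsonScalapino2010, §III] -/
theorem channelInf_A1g_ge_of_meanZero_bound {μ lam : ℝ} (hμ : μ ∈ Set.Ioo (-4 : ℝ) 0)
    (hlam : ∀ φ : Momentum → ℝ, IsChannelState (squareDispersion 1 0) μ D4Irrep.A1g φ →
      ∫ k, φ k ∂fermiCurveMeasure (squareDispersion 1 0) μ = 0 → lam ≤ pairingForm (squareDispersion 1 0) μ 1 φ) :
    ∃ C : ℝ, 0 ≤ C ∧ ∀ U ∈ Set.Ioo (0:ℝ) 1,
      U ^ 2 * lam - C * U ^ 3 ≤ channelInf (squareDispersion 1 0) μ U D4Irrep.A1g := by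
  obtain ⟨C, hC, h⟩ := stub_a1gReduction hμ hlam
  refine ⟨C, hC, fun U hU => ?_⟩
  obtain ⟨ψ₀, hψ₀⟩ := nonempty_isChannelState hμ.1 hμ.2 D4Irrep.A1g
  exact le_csInf ⟨_, ψ₀, hψ₀, rfl⟩ (by rintro _ ⟨ψ, hψ, rfl⟩; exact h U hU ψ hψ)

/-- **From the `U`-free certificate to the leading datum** at a band level `μ ∈ (-4,0)`: a margin `γ > 0`, the inequalities
`Λ_1(B1g) + γ ≤ Λ_1(χ)` for `χ ∉ {B1g, A1g}` and the mean-zero `A1g` bound `Λ_1(B1g) + γ ≤ ⟨φ, Γ_1 φ⟩` give `U₁ > 0` with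
`Λ_U(B1g) + (γ/2)U² ≤ Λ_U(χ)` for all `U ∈ (0,U₁)`, `χ ≠ B1g`: off `A1g` by `U²`-homogeneity and the bare-`U` penalty; for
`A1g`, `Λ_U(A1g) ≥ U²(Λ_1(B1g) + γ) - C U³ ≥ Λ_U(B1g) + (γ/2)U²` once `C U ≤ γ/2` (`U₁ = min 1 (γ/(2C+1))`).
[cite: RaghuKivelsonScalapino2010, §III] -/
theorem leading_of_klCertificateAt {μ γ : ℝ} (hμ : μ ∈ Set.Ioo (-4 : ℝ) 0) (hγ : 0 < γ)
    (hoff : ∀ χ : D4Irrep, χ ≠ D4Irrep.B1g → χ ≠ D4Irrep.A1g →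
      channelInf (squareDispersion 1 0) μ 1 D4Irrep.B1g + γ ≤ channelInf (squareDispersion 1 0) μ 1 χ)
    (hA : ∀ φ : Momentum → ℝ, IsChannelState (squareDispersion 1 0) μ D4Irrep.A1g φ →
      ∫ k, φ k ∂fermiCurveMeasure (squareDispersion 1 0) μ = 0 →
        channelInf (squareDispersion 1 0) μ 1 D4Irrep.B1g + γ ≤ pairingForm (squareDispersion 1 0) μ 1 φ) :
    ∃ U₁ : ℝ, 0 < U₁ ∧ ∀ U ∈ Set.Ioo (0:ℝ) U₁, ∀ χ : D4Irrep, χ ≠ D4Irrep.B1g →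
      channelInf (squareDispersion 1 0) μ U D4Irrep.B1g + γ / 2 * U ^ 2 ≤ channelInf (squareDispersion 1 0) μ U χ := by
  obtain ⟨C, hC, hCU⟩ := channelInf_A1g_ge_of_meanZero_bound hμ hA
  refine ⟨min 1 (γ / (2 * C + 1)), lt_min one_pos (div_pos hγ (by linarith)), fun U hU χ hχ => ?_⟩
  have hU0 : 0 < U := hU.1
  have hU1 : U < 1 := lt_of_lt_of_le hU.2 (min_le_left _ _)
  have hUγ : U < γ / (2 * C + 1) := lt_of_lt_of_le hU.2 (min_le_right _ _)
  have hCUle : C * U ≤ γ / 2 := by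
    have h1 : U * (2 * C + 1) < γ := (lt_div_iff₀ (by linarith)).1 hUγ
    nlinarith
  have hB : channelInf (squareDispersion 1 0) μ U D4Irrep.B1g = U ^ 2 * channelInf (squareDispersion 1 0) μ 1 D4Irrep.B1g :=
    channelInf_sq_of_ne_A1g hμ U (by decide)
  have hU2 : 0 ≤ U ^ 2 := sq_nonneg U
  by_cases hχA : χ = D4Irrep.A1g
  · subst hχA
    have h := hCU U ⟨hU0, hU1⟩
    rw [hB]
    have hU3 : C * U ^ 3 ≤ γ / 2 * U ^ 2 := by nlinarith
    nlinarith
  · have hχ' := channelInf_sq_of_ne_A1g hμ U hχA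
    have hpen := kl_rl_sq_channelInf_one_le hμ.1 hμ.2 hU0 hU1.le χ
    have h1 := mul_le_mul_of_nonneg_left (hoff χ hχ hχA) hU2
    rw [hB]
    nlinarith

/-! ### The anchor from the `U`-free certificate -/

/-- **The anchor from the `U`-FREE certificate (registered stub `cwThesis_of_klCanonical_of_klCertificate` of line
`SketchIdeator3` v6).** `TorusCooperLog.KLCanonical` (stmt-HubbardSuperconductivity-2681) and, at ONE doping
`δ₀ ∈ [3/10, 12/25]` with `μ = μ_δ₀`: a margin `γ > 0`, the `U`-free inequalities `Λ_1(μ,B1g) + γ ≤ Λ_1(μ,χ)` for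
`χ ∉ {B1g, A1g}` and the mean-zero `A1g` bound `Λ_1(μ,B1g) + γ ≤ ⟨φ, Γ_1 φ⟩` (`φ` an `A1g` channel state with `∫φ dσ = 0`) —
give the crux `ChiralWindow.CwThesis`: `leading_of_klCertificateAt` at `μ_δ₀ ∈ (-4,0)` (`stub_klMuWindow`) feeds
`cwThesis_of_klCanonical_of_leading`. The certificate is crux-2682-type certified numerics (expected at `δ₀ = 3/10 … 2/5`, where
the non-certified census of the crux-1741 chain has `B1g` leading with `U = 1` margin `≈ 7·10⁻³`). [folklore] -/
theorem cwThesis_of_klCanonical_of_klCertificate (hKL : TorusCooperLog.KLCanonical)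
    (hcert : ∃ δ₀ ∈ Set.Icc (3/10 : ℝ) (12/25), ∃ γ : ℝ, 0 < γ ∧
      (∀ χ : D4Irrep, χ ≠ D4Irrep.B1g → χ ≠ D4Irrep.A1g →
        channelInf (squareDispersion 1 0) (chemicalPotentialOfDensity (squareDispersion 1 0) (1 - δ₀)) 1 D4Irrep.B1g + γ ≤
          channelInf (squareDispersion 1 0) (chemicalPotentialOfDensity (squareDispersion 1 0) (1 - δ₀)) 1 χ) ∧
      (∀ φ : Momentum → ℝ,
        IsChannelState (squareDispersion 1 0) (chemicalPotentialOfDensity (squareDispersion 1 0) (1 - δ₀)) D4Irrep.A1g φ →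
        ∫ k, φ k ∂fermiCurveMeasure (squareDispersion 1 0) (chemicalPotentialOfDensity (squareDispersion 1 0) (1 - δ₀)) = 0 →
          channelInf (squareDispersion 1 0) (chemicalPotentialOfDensity (squareDispersion 1 0) (1 - δ₀)) 1 D4Irrep.B1g + γ ≤
            pairingForm (squareDispersion 1 0) (chemicalPotentialOfDensity (squareDispersion 1 0) (1 - δ₀)) 1 φ)) :
    ChiralWindow.CwThesis := by
  obtain ⟨δ₀, hδ₀, γ, hγ, hoff, hA⟩ := hcert
  have hμ := stub_klMuWindow δ₀ hδ₀
  obtain ⟨U₁, hU₁, hlead⟩ := leading_of_klCertificateAt hμ hγ hoff hA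
  exact cwThesis_of_klCanonical_of_leading hKL ⟨δ₀, hδ₀, γ / 2, U₁, by positivity, hU₁, hlead⟩

/-- **The anchor from the cruder `U = 1` certificate**: `KLCanonical` and `∀ χ ≠ B1g, Λ_1(μ_δ₀,B1g) + γ ≤ Λ_1(μ_δ₀,χ)` at one
`δ₀ ∈ [3/10, 12/25]` (`γ > 0`) give the crux — directly (`leading_of_certificateOne`, `U₁ = 1`) or through
`klCertificate_of_certificateOne`. [folklore] -/
theorem cwThesis_of_klCanonical_of_certificateOne (hKL : TorusCooperLog.KLCanonical)
    (hcert : ∃ δ₀ ∈ Set.Icc (3/10 : ℝ) (12/25), ∃ γ : ℝ, 0 < γ ∧ ∀ χ : D4Irrep, χ ≠ D4Irrep.B1g →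
      channelInf (squareDispersion 1 0) (chemicalPotentialOfDensity (squareDispersion 1 0) (1 - δ₀)) 1 D4Irrep.B1g + γ ≤
        channelInf (squareDispersion 1 0) (chemicalPotentialOfDensity (squareDispersion 1 0) (1 - δ₀)) 1 χ) :
    ChiralWindow.CwThesis := by
  obtain ⟨δ₀, hδ₀, γ, hγ, h⟩ := hcert
  exact cwThesis_of_klCanonical_of_leading hKL
    ⟨δ₀, hδ₀, γ, 1, hγ, one_pos, leading_of_certificateOne (stub_klMuWindow δ₀ hδ₀) h⟩

end Summit.HubbardSuperconductivity.HubbardSuperconductivity.Theorems.CwThesis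

end
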